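import Summits.BirchSwinnertonDyer.BirchSwinnertonDyer.Theorems.ResidualThetaTransportAtTwoKatoZetaDefs
import Summits.BirchSwinnertonDyer.BirchSwinnertonDyer.Theorems.ThetaPartnerAtTwoSignedKatoUpToAtTwoKatoBKCoreKZLit
import Literature.NumberTheory.EllipticCurves.CMNewformGamma0LevelSquarefull
import Literature.NumberTheory.EllipticCurves.Kato2004.IwasawaCohomologyCoeffNewform
import HarnessLib

/-!
# Sketch (stub-ideation k = 3, g28) — CHILD A of `stub_cmLambdaLower` ≡ RSL_g, decomposed along the seam FORCED BY TYPABILITY: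
# `Kato125ρ_Lit` (Literature vocabulary) ∘ BRIDGE (kernel, TP2 lemmas BY NAME) ⟹ `∃ …, π.KatoValuedClass …` (child A's conclusion at the pins)

Crux `ResidualThetaCountLowerPureAtTwo` (stmt-BirchSwinnertonDyer-26074), stub `stub_cmLambdaLower` = RSL_g (22608), node `stub_kzgChildA`
(onepair.lean v3g ll.100–102; hold item 24105 child A `KatoZetaValuedClassCMAtTwo`; texts v2 sha16 047eb7f8b5baac2e). Written for the
typer seats `bsd-armP-typer-22608-Kato125{,b}` minted by director-bsd g18 (395)(5) and the pen's TYPER-SHAPE memo (evidence #10 on 24105).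

FINDING. The bodies of `KatoBKCoord` / `KatoValCoord` (KatoZetaDefs ll.118–152) are NOT Literature-typable verbatim: they use the SUMMITS-ONLY
constants `PadicCyclotomicTower.zeta` (via `HondaLog.zeta_pow_prime_pow_self`), `BallEval.ptLogΩ`, `toLoc`/`genFibΩ`/`genFibΩ_eq_baseChange`,
`LocalTwo.baseChange_twoAdicModel`, `isIntegral_genFib_baseChange`. (`KatoTrivCoord`, `CoordNondeg`, all pins data and every other binder ARE
Literature-level.) TP2 met the identical obstruction for `T₂W` and solved it with `KatoBK.coreKZ_of_coreKZLit` (CORE_KZ_Lit → CORE_KZ).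

THIS FILE (nothing asserted about any curve or form; every theorem is kernel-checked glue; NO `sorry`):
* §1 `KatoBKCoordLit`, `KatoValCoordLit` — the two clauses re-displayed in Literature + Mathlib vocabulary over the pins data
  (formal-group condition `|x(Q₀)| > 1`, logarithm `Σᵢ logᵢ(W ⊗ ℚ₂) z(Q₀)ⁱ`, Gauss-sum root a ∀-bound primitive tower `ζ₂` to which `τ` is tied);
  `Kato125LitAtPins` — child A's print input in that vocabulary (what the typer's named fact says once `π.X ↦ X`).
* §2 the BRIDGE, proved: `katoBKCoord_of_lit` (TP2's `ptLogΩ_toLoc_symm_eq` + `toLoc_symm_mem_kernel_iff`, by name), `katoValCoord_of_lit`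
  (frame instantiation `ζ₂ := zeta 2`, proof-irrelevant Gauss-sum root), and `childA_conclusion_of_litAtPins :
  Kato125LitAtPins π g ι Ω → ∀ F : π.KatoFrame, ∃ z c′ w q μt, π.KatoValuedClass g ι Ω F.Φ F.τ z c′ w q μt` — child A's conclusion VERBATIM.
* §3 the PIN-FREE shape `Kato125CoeffTwoLitShape : Prop` (every pins field ∀-bound, `Θ hΘ I` at the place `v`; byte-identical to the companion
  file `Sketch_sidea_k3_g28_litonly.lean`, which states it importing ONLY `Literature.*` + Mathlib — rc 0) and the FULL PORT REHEARSAL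
  `stub_kzgChildA_of_pinFreeShape : Kato125CoeffTwoLitShape → <stub_kzgChildA's registered text, onepair.lean v3g l.101, VERBATIM>` —
  `intro` the 53 binders, `exact childA_conclusion_of_litAtPins π g ι Ω (fun Φ φ hΦφ ζ₂ hζ₂ τ hτ => hK π.v π.hv W … π.hpair Φ φ hΦφ ζ₂ hζ₂ τ hτ) F`.
BSD is not proved by anything here; 22608 / 26074 / 24105 stay OPEN / HOLD; no route, registry or Theorems object is touched.
-/

set_option autoImplicit false
set_option linter.dupNamespace false
set_option backward.isDefEq.respectTransparency false

noncomputable section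

open scoped Classical NumberField TensorProduct

namespace Summit.BirchSwinnertonDyer.BirchSwinnertonDyer.Cruxes.ResidualThetaCountLowerPureAtTwo.SideaK3G28

open Literature.NumberTheory.EllipticCurves Literature.NumberTheory.EllipticCurves.GreenbergSelmer
open Literature.NumberTheory.GaloisRepresentations NumberField IsDedekindDomain Field
open GreenbergVatsal2000 Kobayashi2003 Rat.HeightOneSpectrum PowerSeries
open Literature.NumberTheory.EllipticCurves.FormalGroupChart
open Summit.BirchSwinnertonDyer.Rank1Residual.Additive Summit.BirchSwinnertonDyer.Rank1Residual.Additive.PadicCyclotomicTower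
  Summit.BirchSwinnertonDyer.Rank1Residual.Additive.BallEval
open Summit.BirchSwinnertonDyer.BirchSwinnertonDyer.Theorems.SignedKatoOffTwo
  Summit.BirchSwinnertonDyer.BirchSwinnertonDyer.Theorems.SignedKatoOffTwo.LocalTwo
open Summit.BirchSwinnertonDyer.BirchSwinnertonDyer.Theorems.OnePair

variable {S : Set (PadicAlgCl 2)} {W : WeierstrassCurve ℚ} [W.IsElliptic] {κ : ZpExtension ℚ 2} {γ : absoluteGaloisGroup ℚ}
  {S₀ : Finset (HeightOneSpectrum (𝓞 ℚ))} {n : ℕ} {ρ : FramedGaloisRep ℚ ↥(padicCoeffIntegers S) 2}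
  {Θ : ∀ v : HeightOneSpectrum (𝓞 ℚ), ((2 : ℕ) : 𝓞 ℚ) ∈ v.asIdeal → (Cofree ρ ↥(padicCoeffField S) ≃+ (Fin n → ↥(W.geomPrimaryTorsion 2)))}
  {hΘ : ∀ v hv (δ : absoluteGaloisGroup (v.adicCompletion ℚ)) m i,
    Θ v hv (resGalOfEmb (closureEmb (K := ℚ) (v.adicCompletion ℚ)) δ • m) i = resGalOfEmb (closureEmb (K := ℚ) (v.adicCompletion ℚ)) δ • Θ v hv m i}
  {I : Kato2004.IwasawaH1DataCoeff (FramedGaloisRep.toGaloisRep ρ) 2 κ γ}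
  {Sg : AddSubgroup (subgroupH1 κ.kerSubgroup (Cofree ρ ↥(padicCoeffField S)))} [Module ↥(padicCoeffIntegers S) ↥Sg]
  (π : OnePairPins S W κ γ S₀ n ρ Θ hΘ I Sg)

/-! ## §1 The two non-Literature clauses, re-displayed in Literature + Mathlib vocabulary (data: `π.v, π.t₀, π.nb, π.bO, π.pair, I.proj`) -/

/-- **(BKρ-Lit)** — `KatoBKCoord` with the formal-group condition written as the carrier condition `|x(Q₀)| > 1` and the logarithm as the formal
logarithm of `W ⊗ ℚ₂` at `z(Q₀)` (exactly CORE_KZ_Lit's phrasing in `KatoBK.coreKZ_of_coreKZLit`). Every constant is Literature/Mathlib.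
Nothing asserted. [cite: BlochKato1990, §3 (3.10.1), (3.11)] [cite: Kato2004Asterisque, Thm. 12.5 (1) (pp. 221–222)] -/
def KatoBKCoordLit (Φ : AlgebraicClosure ℚ_[2] ≃ₐ[ℚ] AlgebraicClosure (π.v.adicCompletion ℚ))
    (τ : ∀ m : ℕ, ZMod (2 ^ m) → Field.absoluteGaloisGroup ℚ_[2])
    (z : I.H) (c' : Fin n → ↥(padicCoeffIntegers S)) (w : ℕ → Fin π.nb → PadicAlgCl 2) : Prop :=
  ∀ (a : ↥(padicCoeffIntegers S)) (m : ℕ) (i : Fin n) (Q₀ : localPoints W ℚ_[2])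
    (hQv : WeierstrassCurve.Affine.Point.map (W' := W)
        (Φ : AlgebraicClosure ℚ_[2] →ₐ[ℚ] AlgebraicClosure (π.v.adicCompletion ℚ))
        (show (W.baseChange (AlgebraicClosure ℚ_[2])).toAffine.Point from Q₀) ∈
      localLayerPointsOfEmb κ (closureEmb (K := ℚ) (π.v.adicCompletion ℚ)) W m),
    (∀ (X Y : AlgebraicClosure ℚ_[2]) (hXY : (W.baseChange (AlgebraicClosure ℚ_[2])).toAffine.Nonsingular X Y),
        (show (W.baseChange (AlgebraicClosure ℚ_[2])).toAffine.Point from Q₀) = .some X Y hXY → 1 < Valued.v X) →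
    algebraMap ℚ_[2] (PadicAlgCl 2)
        ((π.pair m (I.proj m ((PowerSeries.C a : IwasawaAlgebraO S) • z)) (Pi.single i ⟨_, hQv⟩) : ℤ_[2]) : ℚ_[2]) =
      ∑ j : Fin π.nb, algebraMap ℚ_[2] (PadicAlgCl 2) ((π.t₀ (c' i * a * π.bO j) : ℤ_[2]) : ℚ_[2]) *
        ∑ b : (ZMod (2 ^ (m + 2)))ˣ, τ (m + 2) (b : ZMod (2 ^ (m + 2))) •
          ((∑' l : ℕ, algebraMap ℚ_[2] (PadicAlgCl 2) (PowerSeries.coeff l (W.map (algebraMap ℚ ℚ_[2])).formalLog) *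
              (WeierstrassCurve.Affine.Point.zCoord (show (W.baseChange (AlgebraicClosure ℚ_[2])).toAffine.Point from Q₀)) ^ l) *
            w (m + 2) j)

/-- **(VALρ-Lit)** — `KatoValCoord` with the Gauss-sum root a ∀-bound PRIMITIVE tower `ζ₂ k ∈ μ_{2^k}(ℚ̄₂)` (the port takes
`ζ₂ := PadicCyclotomicTower.zeta 2`; `τ` is tied to `ζ₂` by the fact's frame hypothesis). Every constant is Literature/Mathlib. Nothing asserted.
[cite: Kato2004Asterisque, Thm. 12.5 (1) (pp. 221–222), §15.16 (p. 265)] -/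
def KatoValCoordLit {M : ℕ} [NeZero M] (g : CuspForm (CongruenceSubgroup.Gamma0 M) 2) (ι : ModularForms.coeffField g →+* PadicAlgCl 2)
    (Ω : ℂ) (ζ₂ : ℕ → PadicAlgCl 2) (hζ₂ : ∀ k : ℕ, IsPrimitiveRoot (ζ₂ k) (2 ^ k))
    (τ : ∀ m : ℕ, ZMod (2 ^ m) → Field.absoluteGaloisGroup ℚ_[2])
    (w : ℕ → Fin π.nb → PadicAlgCl 2) (q : PadicAlgCl 2) (μt : IwasawaAlgebraO S) : Prop :=
  ∀ (m : ℕ) (ψ : DirichletCharacter (PadicAlgCl 2) (2 ^ (m + 2))), ψ (-1) = 1 → ψ.IsPrimitive →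
    algebraMap (PadicAlgCl 2) ℂ_[2]
        ((∑ j : Fin π.nb, ((π.bO j : ↥(padicCoeffIntegers S)) : PadicAlgCl 2) *
            ∑ b : (ZMod (2 ^ (m + 2)))ˣ, ψ⁻¹ (b : ZMod (2 ^ (m + 2))) * τ (m + 2) (b : ZMod (2 ^ (m + 2))) • w (m + 2) j) *
          gaussSum ψ (AddChar.zmodChar (2 ^ (m + 2)) ((hζ₂ (m + 2)).pow_eq_one))) =
      algebraMap (PadicAlgCl 2) ℂ_[2] q *
        (∑' k, algebraMap (PadicAlgCl 2) ℂ_[2] ((PowerSeries.coeff k μt : ↥(padicCoeffIntegers S)) : PadicAlgCl 2) *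
            (algebraMap (PadicAlgCl 2) ℂ_[2] (ψ (5 : ZMod (2 ^ (m + 2)))) - 1) ^ k) *
        algebraMap (PadicAlgCl 2) ℂ_[2]
          (∑ a : ZMod (2 ^ (m + 2)), ψ a * ι (plusSymbolK g Ω ((a.val : ℚ) / (2 : ℚ) ^ (m + 2))))

/-- **Child A's print input in Literature vocabulary, at the pins** (`Kato125ρ_Lit`): for every `2`-adic frame — `Φ` over `φ`, a primitive tower
`ζ₂` and Galois lifts `τ` tied to it — a valued class exists with `q ≠ 0`, `μt ≠ 0`, (ND), (BKρ-Lit), (VALρ-Lit), (TRIVρ). The typer's NAMED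
Literature fact is this `Prop` with the pins fields `π.v π.hv π.t₀ π.ht₀ π.nb π.bO π.bO' π.hbO π.ζ π.hζ π.ePk … π.hePk π.pair π.hpair` and
`Θ hΘ I` ∀-bound (the pen's `π.X ↦ X`). Nothing asserted. [cite: Kato2004Asterisque, Thm. 12.5 (1), 12.6 (pp. 221–223), §15.16 (p. 265)]
[cite: BlochKato1990, §3 (3.10.1), (3.11)] -/
def Kato125LitAtPins {M : ℕ} [NeZero M] (g : CuspForm (CongruenceSubgroup.Gamma0 M) 2) (ι : ModularForms.coeffField g →+* PadicAlgCl 2)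
    (Ω : ℂ) : Prop :=
  ∀ (Φ : AlgebraicClosure ℚ_[2] ≃ₐ[ℚ] AlgebraicClosure (π.v.adicCompletion ℚ)) (φ : ℚ_[2] ≃+* π.v.adicCompletion ℚ),
    (∀ y : ℚ_[2], Φ (algebraMap ℚ_[2] (AlgebraicClosure ℚ_[2]) y) =
      algebraMap (π.v.adicCompletion ℚ) (AlgebraicClosure (π.v.adicCompletion ℚ)) (φ y)) →
  ∀ (ζ₂ : ℕ → PadicAlgCl 2) (hζ₂ : ∀ k : ℕ, IsPrimitiveRoot (ζ₂ k) (2 ^ k))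
    (τ : ∀ m : ℕ, ZMod (2 ^ m) → Field.absoluteGaloisGroup ℚ_[2]),
    (∀ (m : ℕ) (a : ZMod (2 ^ m)), IsUnit a → τ m a • ζ₂ m = ζ₂ m ^ a.val) →
  ∃ (z : I.H) (c' : Fin n → ↥(padicCoeffIntegers S)) (w : ℕ → Fin π.nb → PadicAlgCl 2) (q : PadicAlgCl 2) (μt : IwasawaAlgebraO S),
    q ≠ 0 ∧ μt ≠ 0 ∧ π.CoordNondeg c' ∧ KatoBKCoordLit π Φ τ z c' w ∧ KatoValCoordLit π g ι Ω ζ₂ hζ₂ τ w q μt ∧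
      π.KatoTrivCoord g ι Ω τ w q μt

/-! ## §2 The BRIDGE (kernel, proved): Literature vocabulary ⟹ the registered clauses; child A's conclusion from `Kato125LitAtPins` -/

/-- **(BKρ-Lit) ⟹ (BKρ)** — TP2's plumbing by name: `toLoc_symm_mem_kernel_iff` (formal-group condition) and `KatoBK.ptLogΩ_toLoc_symm_eq`
(`ΛΩ ∘ toLoc⁻¹ = log_{W⊗ℚ₂} ∘ z`). [cite: SilvermanAEC2009, IV.5, Prop. VII.2.2] -/
theorem katoBKCoord_of_lit [W.IsGloballyMinimal] (Φ : AlgebraicClosure ℚ_[2] ≃ₐ[ℚ] AlgebraicClosure (π.v.adicCompletion ℚ))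
    (τ : ∀ m : ℕ, ZMod (2 ^ m) → Field.absoluteGaloisGroup ℚ_[2])
    (z : I.H) (c' : Fin n → ↥(padicCoeffIntegers S)) (w : ℕ → Fin π.nb → PadicAlgCl 2)
    (h : KatoBKCoordLit π Φ τ z c' w) : π.KatoBKCoord Φ τ z c' w := by
  haveI := isIntegral_genFib_baseChange 2 ((WeierstrassCurve.integralModelInt W).map (Int.castRingHom ℤ_[2]))
  intro a m i Q₀ hQv hker
  have hker' := (toLoc_symm_mem_kernel_iff (W := W)
    ((genFibΩ_eq_baseChange ((WeierstrassCurve.integralModelInt W).map (Int.castRingHom ℤ_[2]))).trans (baseChange_twoAdicModel W)) Q₀).mp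
    hker
  rw [KatoBK.ptLogΩ_toLoc_symm_eq]
  exact h a m i Q₀ hQv hker'

/-- **(VALρ-Lit) at the tree's tower `zeta 2` ⟹ (VALρ)** — the Gauss-sum roots agree on the nose (`AddChar.zmodChar` is proof-irrelevant in the
root-of-unity witness: `(isPrimitiveRoot_zeta 2 k).pow_eq_one` vs `HondaLog.zeta_pow_prime_pow_self k`). [folklore] -/
theorem katoValCoord_of_lit {M : ℕ} [NeZero M] (g : CuspForm (CongruenceSubgroup.Gamma0 M) 2)
    (ι : ModularForms.coeffField g →+* PadicAlgCl 2) (Ω : ℂ) (τ : ∀ m : ℕ, ZMod (2 ^ m) → Field.absoluteGaloisGroup ℚ_[2])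
    (w : ℕ → Fin π.nb → PadicAlgCl 2) (q : PadicAlgCl 2) (μt : IwasawaAlgebraO S)
    (h : KatoValCoordLit π g ι Ω (zeta 2) (isPrimitiveRoot_zeta 2) τ w q μt) : π.KatoValCoord g ι Ω τ w q μt := by
  intro m ψ hψ hprim
  exact h m ψ hψ hprim

/-- **CHILD A's conclusion from the Literature-vocabulary input** — the A1∘A2 glue of the proposed split, PROVED: instantiate the frame of
`Kato125LitAtPins` at `(F.Φ, F.φ, F.hΦφ, zeta 2, isPrimitiveRoot_zeta 2, F.τ, F.hτ)` and bridge the two clauses. The conclusion is the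
conclusion of `stub_kzgChildA` (onepair.lean v3g) VERBATIM at the pins `π`. [cite: Kato2004Asterisque, Thm. 12.5 (1) (pp. 221–222)] -/
theorem childA_conclusion_of_litAtPins [W.IsGloballyMinimal] {M : ℕ} [NeZero M] (g : CuspForm (CongruenceSubgroup.Gamma0 M) 2)
    (ι : ModularForms.coeffField g →+* PadicAlgCl 2) (Ω : ℂ) (hK : Kato125LitAtPins π g ι Ω) (F : π.KatoFrame) :
    ∃ (z : I.H) (c' : Fin n → ↥(padicCoeffIntegers S)) (w : ℕ → Fin π.nb → PadicAlgCl 2) (q : PadicAlgCl 2) (μt : IwasawaAlgebraO S),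
      π.KatoValuedClass g ι Ω F.Φ F.τ z c' w q μt := by
  obtain ⟨z, c', w, q, μt, hq, hμ, hnd, hBK, hVAL, hTRIV⟩ :=
    hK F.Φ F.φ F.hΦφ (zeta 2) (isPrimitiveRoot_zeta 2) F.τ F.hτ
  exact ⟨z, c', w, q, μt, hq, hμ, hnd, katoBKCoord_of_lit π F.Φ F.τ z c' w hBK, katoValCoord_of_lit π g ι Ω F.τ w q μt hVAL, hTRIV⟩

/-- **Converse of the (BKρ) bridge** (so the Literature re-display loses nothing: (BKρ) ⟺ (BKρ-Lit)). [folklore] -/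
theorem lit_of_katoBKCoord [W.IsGloballyMinimal] (Φ : AlgebraicClosure ℚ_[2] ≃ₐ[ℚ] AlgebraicClosure (π.v.adicCompletion ℚ))
    (τ : ∀ m : ℕ, ZMod (2 ^ m) → Field.absoluteGaloisGroup ℚ_[2])
    (z : I.H) (c' : Fin n → ↥(padicCoeffIntegers S)) (w : ℕ → Fin π.nb → PadicAlgCl 2)
    (h : π.KatoBKCoord Φ τ z c' w) : KatoBKCoordLit π Φ τ z c' w := by
  haveI := isIntegral_genFib_baseChange 2 ((WeierstrassCurve.integralModelInt W).map (Int.castRingHom ℤ_[2]))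
  intro a m i Q₀ hQv hfg
  have hker : (toLoc ((genFibΩ_eq_baseChange ((WeierstrassCurve.integralModelInt W).map (Int.castRingHom ℤ_[2]))).trans
      (baseChange_twoAdicModel W))).symm Q₀ ∈
      kernel (Valued.v (R := PadicAlgCl 2)) (genFibΩ 2 ((WeierstrassCurve.integralModelInt W).map (Int.castRingHom ℤ_[2]))) :=
    (toLoc_symm_mem_kernel_iff (W := W)
      ((genFibΩ_eq_baseChange ((WeierstrassCurve.integralModelInt W).map (Int.castRingHom ℤ_[2]))).trans (baseChange_twoAdicModel W)) Q₀).mpr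
      (by intro X Y hXY hQ; exact hfg X Y hXY hQ)
  have := h a m i Q₀ hQv hker
  rw [KatoBK.ptLogΩ_toLoc_symm_eq] at this
  exact this


/-! ## §3 The PIN-FREE shape (Literature + Mathlib vocabulary; the companion file `Sketch_sidea_k3_g28_litonly.lean` states the SAME `Prop`
importing only `Literature.*` + Mathlib, rc 0) and the FULL PORT REHEARSAL: `Kato125CoeffTwoLitShape → stub_kzgChildA's text VERBATIM` -/

open Literature.NumberTheory.EllipticCurves.ModularForms in
set_option maxHeartbeats 1600000 in
/-- **`Kato125ρ_Lit`, pin-free** — byte-identical body to the Literature-only companion file's `Kato125CoeffTwoLitShape` (there in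
`namespace Literature.NumberTheory.EllipticCurves.Kato2004.SideaK3G28`); duplicated here so this file is self-contained. Nothing asserted.
[cite: Kato2004Asterisque, Thm. 12.5 (1) (pp. 221–222)] [cite: BlochKato1990, §3 (3.10.1), (3.11)] -/
def Kato125CoeffTwoLitShape : Prop :=
  ∀ (v : HeightOneSpectrum (𝓞 ℚ)) (hv : ((2 : ℕ) : 𝓞 ℚ) ∈ v.asIdeal)
    (W : WeierstrassCurve ℚ) [W.IsElliptic] [W.IsGloballyMinimal]
    (κ : ZpExtension ℚ 2) (γ : absoluteGaloisGroup ℚ), κ.IsCyclotomic → κ.IsTopGenerator γ →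
  ∀ (M : ℕ) [NeZero M] (g : CuspForm (CongruenceSubgroup.Gamma0 M) 2) (ι : coeffField g →+* PadicAlgCl 2) (Ω : ℂ),
    IsNewform0 g → cuspCoeff g 2 = 0 → IsCohomologicalPlusPeriod g ι Ω →
  ∀ (n : ℕ) (ρ : FramedGaloisRep ℚ ↥(padicCoeffIntegers (Set.range ι)) 2),
    (∀ v' : HeightOneSpectrum (𝓞 ℚ), ¬ natGenerator v' ∣ 2 * M → ρ.IsUnramifiedAt v' ∧
      ∃ P : Polynomial ↥(padicCoeffIntegers (Set.range ι)),
        P.map (padicCoeffIntegers (Set.range ι)).subtype =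
          Polynomial.X ^ 2 - Polynomial.C (embCoeff g ι (natGenerator v')) * Polynomial.X + Polynomial.C ((natGenerator v' : ℕ) : PadicAlgCl 2) ∧
        ρ.HasFrobCharpolyAt v' P) →
  ∀ (Θ : Cofree ρ ↥(padicCoeffField (Set.range ι)) ≃+ (Fin n → ↥(W.geomPrimaryTorsion 2)))
    (hΘ : ∀ (δ : absoluteGaloisGroup (v.adicCompletion ℚ)) (m : Cofree ρ ↥(padicCoeffField (Set.range ι))) (i : Fin n),
      Θ (resGalOfEmb (closureEmb (K := ℚ) (v.adicCompletion ℚ)) δ • m) i = resGalOfEmb (closureEmb (K := ℚ) (v.adicCompletion ℚ)) δ • Θ m i)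
    (t₀ : ↥(padicCoeffIntegers (Set.range ι)) →+ ℤ_[2])
    (_ht₀ : ∀ (c : ℤ_[2]) (a : ↥(padicCoeffIntegers (Set.range ι))), t₀ (padicIntToCoeffIntegers (Set.range ι) c * a) = c * t₀ a)
    (nb : ℕ) (bO bO' : Fin nb → ↥(padicCoeffIntegers (Set.range ι)))
    (_hbO : ∀ a : ↥(padicCoeffIntegers (Set.range ι)), a = ∑ i, padicIntToCoeffIntegers (Set.range ι) (t₀ (a * bO' i)) * bO i)
    (ζ : ℕ → AlgebraicClosure ℚ) (_hζ : ∀ k, IsPrimitiveRoot (ζ k) (2 ^ k))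
    (ePk : ∀ k : ℕ, ↥(AddSubgroup.torsionBy (Cofree ρ ↥(padicCoeffField (Set.range ι))) ((2 ^ k : ℕ) : ℤ)) →
      ↥(AddSubgroup.torsionBy (Cofree ρ ↥(padicCoeffField (Set.range ι))) ((2 ^ k : ℕ) : ℤ)) → AlgebraicClosure ℚ)
    (hμPk : ∀ k a b, ePk k a b ^ (2 ^ k) = 1)
    (hadd₁Pk : ∀ k a₁ a₂ b, ePk k (a₁ + a₂) b = ePk k a₁ b * ePk k a₂ b)
    (hadd₂Pk : ∀ k a b₁ b₂, ePk k a (b₁ + b₂) = ePk k a b₁ * ePk k a b₂)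
    (hgalPk : ∀ k (σ : absoluteGaloisGroup ℚ)
      (a b : ↥(AddSubgroup.torsionBy (Cofree ρ ↥(padicCoeffField (Set.range ι))) ((2 ^ k : ℕ) : ℤ))),
      σ • ePk k a b = ePk k (cofreeTorsionGaloisModule (Set.range ι) ρ _ σ a) (cofreeTorsionGaloisModule (Set.range ι) ρ _ σ b))
    (_hePk : ∀ k (s t : Fin 2 → ↥(padicCoeffIntegers (Set.range ι))),
      ePk k (divPowCofreeMkTorsion (Set.range ι) ρ k s) (divPowCofreeMkTorsion (Set.range ι) ρ k t) =
        ζ k ^ (PadicInt.toZModPow k (t₀ (s 0 * t 1 - s 1 * t 0))).val)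
    (I : Kato2004.IwasawaH1DataCoeff (FramedGaloisRep.toGaloisRep ρ) 2 κ γ) [Module ↥(padicCoeffIntegers (Set.range ι)) I.H]
    [IsScalarTower ↥(padicCoeffIntegers (Set.range ι)) (IwasawaAlgebraO (Set.range ι)) I.H],
    (∀ (a : ↥(padicCoeffIntegers (Set.range ι))) (x : I.H), a • x = (PowerSeries.C a : IwasawaAlgebraO (Set.range ι)) • x) →
  ∀ (pair : ∀ m : ℕ, H1 (FramedGaloisRep.toGaloisRep ρ) (κ.layerSubgroup m) →+
      ((Fin n → ↥(localLayerPointsOfEmb κ (closureEmb (K := ℚ) (v.adicCompletion ℚ)) W m)) →+ ℤ_[2])),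
    (∀ (m k : ℕ) (x : H1 (FramedGaloisRep.toGaloisRep ρ) (κ.layerSubgroup m))
      (Q : Fin n → ↥(localLayerPointsOfEmb κ (closureEmb (K := ℚ) (v.adicCompletion ℚ)) W m)),
      PadicInt.toZModPow k (pair m x Q) =
        CyclotomicLayer.rhoLayerPairingPk (Set.range ι) ρ W ePk hμPk hadd₁Pk hadd₂Pk hgalPk Θ κ v hΘ m k x Q) →
  -- the `2`-adic frame: `Φ` over `φ`, a PRIMITIVE root tower `ζ₂` in `ℚ̄₂`, Galois lifts `τ` tied to it
  ∀ (Φ : AlgebraicClosure ℚ_[2] ≃ₐ[ℚ] AlgebraicClosure (v.adicCompletion ℚ)) (φ : ℚ_[2] ≃+* v.adicCompletion ℚ),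
    (∀ y : ℚ_[2], Φ (algebraMap ℚ_[2] (AlgebraicClosure ℚ_[2]) y) =
      algebraMap (v.adicCompletion ℚ) (AlgebraicClosure (v.adicCompletion ℚ)) (φ y)) →
  ∀ (ζ₂ : ℕ → PadicAlgCl 2) (hζ₂ : ∀ k : ℕ, IsPrimitiveRoot (ζ₂ k) (2 ^ k))
    (τ : ∀ m : ℕ, ZMod (2 ^ m) → absoluteGaloisGroup ℚ_[2]),
    (∀ (m : ℕ) (a : ZMod (2 ^ m)), IsUnit a → τ m a • ζ₂ m = ζ₂ m ^ a.val) →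
  ∃ (z : I.H) (c' : Fin n → ↥(padicCoeffIntegers (Set.range ι))) (w : ℕ → Fin nb → PadicAlgCl 2) (q : PadicAlgCl 2)
    (μt : IwasawaAlgebraO (Set.range ι)),
    q ≠ 0 ∧ μt ≠ 0 ∧
    -- (ND)
    Function.Injective (fun (a : ↥(padicCoeffIntegers (Set.range ι))) (i : Fin n) => t₀ (c' i * a)) ∧
    -- (BKρ-Lit)
    (∀ (a : ↥(padicCoeffIntegers (Set.range ι))) (m : ℕ) (i : Fin n) (Q₀ : localPoints W ℚ_[2])
      (hQv : WeierstrassCurve.Affine.Point.map (W' := W)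
          (Φ : AlgebraicClosure ℚ_[2] →ₐ[ℚ] AlgebraicClosure (v.adicCompletion ℚ))
          (show (W.baseChange (AlgebraicClosure ℚ_[2])).toAffine.Point from Q₀) ∈
        localLayerPointsOfEmb κ (closureEmb (K := ℚ) (v.adicCompletion ℚ)) W m),
      (∀ (X Y : AlgebraicClosure ℚ_[2]) (hXY : (W.baseChange (AlgebraicClosure ℚ_[2])).toAffine.Nonsingular X Y),
          (show (W.baseChange (AlgebraicClosure ℚ_[2])).toAffine.Point from Q₀) = .some X Y hXY → 1 < Valued.v X) →
      algebraMap ℚ_[2] (PadicAlgCl 2)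
          ((pair m (I.proj m ((PowerSeries.C a : IwasawaAlgebraO (Set.range ι)) • z)) (Pi.single i ⟨_, hQv⟩) : ℤ_[2]) : ℚ_[2]) =
        ∑ j : Fin nb, algebraMap ℚ_[2] (PadicAlgCl 2) ((t₀ (c' i * a * bO j) : ℤ_[2]) : ℚ_[2]) *
          ∑ b : (ZMod (2 ^ (m + 2)))ˣ, τ (m + 2) (b : ZMod (2 ^ (m + 2))) •
            ((∑' l : ℕ, algebraMap ℚ_[2] (PadicAlgCl 2) (PowerSeries.coeff l (W.map (algebraMap ℚ ℚ_[2])).formalLog) *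
                (WeierstrassCurve.Affine.Point.zCoord (show (W.baseChange (AlgebraicClosure ℚ_[2])).toAffine.Point from Q₀)) ^ l) *
              w (m + 2) j)) ∧
    -- (VALρ-Lit)
    (∀ (m : ℕ) (ψ : DirichletCharacter (PadicAlgCl 2) (2 ^ (m + 2))), ψ (-1) = 1 → ψ.IsPrimitive →
      algebraMap (PadicAlgCl 2) ℂ_[2]
          ((∑ j : Fin nb, ((bO j : ↥(padicCoeffIntegers (Set.range ι))) : PadicAlgCl 2) *
              ∑ b : (ZMod (2 ^ (m + 2)))ˣ, ψ⁻¹ (b : ZMod (2 ^ (m + 2))) * τ (m + 2) (b : ZMod (2 ^ (m + 2))) • w (m + 2) j) *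
            gaussSum ψ (AddChar.zmodChar (2 ^ (m + 2)) ((hζ₂ (m + 2)).pow_eq_one))) =
        algebraMap (PadicAlgCl 2) ℂ_[2] q *
          (∑' k, algebraMap (PadicAlgCl 2) ℂ_[2] ((PowerSeries.coeff k μt : ↥(padicCoeffIntegers (Set.range ι))) : PadicAlgCl 2) *
              (algebraMap (PadicAlgCl 2) ℂ_[2] (ψ (5 : ZMod (2 ^ (m + 2)))) - 1) ^ k) *
          algebraMap (PadicAlgCl 2) ℂ_[2]
            (∑ a : ZMod (2 ^ (m + 2)), ψ a * ι (plusSymbolK g Ω ((a.val : ℚ) / (2 : ℚ) ^ (m + 2))))) ∧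
    -- (TRIVρ)
    (∀ k : ℕ, 2 ≤ k → k ≤ 3 →
      ∑ j : Fin nb, ((bO j : ↥(padicCoeffIntegers (Set.range ι))) : PadicAlgCl 2) * ∑ b : (ZMod (2 ^ k))ˣ, τ k (b : ZMod (2 ^ k)) • w k j =
        (3 / 2 : PadicAlgCl 2) * q * ((PowerSeries.coeff 0 μt : ↥(padicCoeffIntegers (Set.range ι))) : PadicAlgCl 2) * ι (plusSymbolK g Ω 0))

set_option maxHeartbeats 1600000 in
/-- **FULL PORT REHEARSAL — child A's registered text (onepair.lean v3g l.100–102, statement bytes VERBATIM incl. the `open … in` prefix) from the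
pin-free Literature-vocabulary shape.** If the typer's named fact has the binder order of `Kato125CoeffTwoLitShape`, the child-A port is this proof
with `hK := Kato2004.<fact>`. Kernel-checked; no `sorry`. Nothing about any curve or form is asserted (the shape is a HYPOTHESIS).
[cite: Kato2004Asterisque, Thm. 12.5 (1) (pp. 221–222)] -/
theorem stub_kzgChildA_of_pinFreeShape (hK : Kato125CoeffTwoLitShape) :
    open Literature.NumberTheory.EllipticCurves GreenbergSelmer GreenbergVatsal2000 Kobayashi2003 ModularForms Rank1Residual Literature.NumberTheory.GaloisRepresentations Literature.NumberTheory.Automorphic IsDedekindDomain NumberField Field Rat.HeightOneSpectrum PowerSeries Summit.BirchSwinnertonDyer.BirchSwinnertonDyer.Theorems.OnePair in ∀ (W : WeierstrassCurve ℚ) [W.IsElliptic] [W.IsGloballyMinimal], ¬ W.HasCM → W.analyticRank = 0 → GoodSS W 2 → W.frobeniusTrace 2 = 0 → W.Δ < 0 → ∀ (M : ℕ) [NeZero M] (g : CuspForm (CongruenceSubgroup.Gamma0 M) 2) (ι : coeffField g →+* PadicAlgCl 2) (Ω : ℂ), Odd M → IsNewform0 g → IsCMForm (liftToGamma1 M 2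 g) → cuspCoeff g 2 = 0 → IsCohomologicalPlusPeriod g ι Ω → (∀ ℓ : ℕ, ℓ.Prime → ¬ ℓ ∣ 2 * M * W.conductorNorm ℤ → ‖embCoeff g ι ℓ - (W.frobeniusTrace ℓ : PadicAlgCl 2)‖ < 1) → ∀ (κ : ZpExtension ℚ 2) (γ : absoluteGaloisGroup ℚ), κ.IsCyclotomic → κ.IsTopGenerator γ → IsCyclotomicVariable 2 γ → ∀ (S₀ : Finset (HeightOneSpectrum (RingOfIntegers ℚ))), (∀ v ∈ S₀, ((2 : ℕ) : RingOfIntegers ℚ) ∉ v.asIdeal) → (∀ v, ¬ W.HasGoodReductionAt v → v ∈ S₀) → (∀ v, natGenerator v ∣ M → v ∈ S₀) → ∀ (Lp Lm : IwasawaAlgebraO (Set.range ι)) (d : ℕ), IsPollackPairK g ι Ω Lp Lm → (∀ k, ‖coeff k (iwasawaOToPowerSeries (Set.range ι) Lm)‖ ≤ ‖coeff d (iwasawaOToPowerSeries (Set.range ι) Lm)‖) → (∀ k < d, ‖coeff k (iwasawaOToPowerSeries (Set.range ι) Lm)‖ < ‖coeff d (iwasawaOToPowerSeries (Set.range ι)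 Lm)‖) → ∀ (n : ℕ) (ρ : FramedGaloisRep ℚ (coeffO (Set.range ι)) 2) (Θ : ∀ v : HeightOneSpectrum (RingOfIntegers ℚ), ((2 : ℕ) : RingOfIntegers ℚ) ∈ v.asIdeal → (CofreeF (Set.range ι) ρ ≃+ (Fin n → ↥(W.geomPrimaryTorsion 2)))), (∀ v, ¬ natGenerator v ∣ 2 * M → ρ.IsUnramifiedAt v ∧ ∃ P : Polynomial (coeffO (Set.range ι)), P.map (padicCoeffIntegers (Set.range ι)).subtype = Polynomial.X ^ 2 - Polynomial.C (embCoeff g ι (natGenerator v)) * Polynomial.X + Polynomial.C ((natGenerator v : ℕ) : PadicAlgCl 2) ∧ ρ.HasFrobCharpolyAt v P) → ∀ (hΘ : ∀ v hv (δ : absoluteGaloisGroup (v.adicCompletion ℚ)) m i, Θ v hv (resGalOfEmb (closureEmb (K := ℚ) (v.adicCompletion ℚ)) δ • m) i = resGalOfEmb (closureEmb (K := ℚ) (v.adicCompletion ℚ)) δ • Θ v hv m i), ∀ (ϖ : (coeffO (Set.range ι))), Irreducible ϖ → ∀ (Sg : AddSubgroup (H1Γ (Set.range ι) κ ρ)) [Module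 (coeffO (Set.range ι)) ↥Sg], (∀ (a : (coeffO (Set.range ι))) (s : ↥Sg), ((a • s : ↥Sg) : H1Γ (Set.range ι) κ ρ) = scalarH1 κ.kerSubgroup (CofreeF (Set.range ι) ρ) a s) → (∀ y : H1Γ (Set.range ι) κ ρ, y ∈ Sg ↔ y ∈ plusSelmerSet (Set.range ι) W κ S₀ n ρ Θ) → (∀ (τ : absoluteGaloisGroup ℚ) (y : H1Γ (Set.range ι) κ ρ), y ∈ Sg → conjH1 κ.kerSubgroup (CofreeF (Set.range ι) ρ) τ y ∈ Sg) → (plusSelmerTorsionSet (Set.range ι) W κ S₀ n ρ Θ ϖ).Finite → ∀ (I : Kato2004.IwasawaH1DataCoeff (FramedGaloisRep.toGaloisRep ρ) 2 κ γ) [Module (coeffO (Set.range ι)) I.H] [IsScalarTower (coeffO (Set.range ι)) (IwasawaAlgebraO (Set.range ι)) I.H], (∀ (a : (coeffO (Set.range ι))) (x : I.H), a • x = (PowerSeries.C a : IwasawaAlgebraO (Set.range ι)) • x) → ∀ (π : OnePairPins (Set.range ι) W κ γ S₀ n ρ Θ hΘ I Sg), ∀ (F : π.KatoFrame), ∃ (z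 : I.H) (c' : Fin n → coeffO (Set.range ι)) (w : ℕ → Fin π.nb → PadicAlgCl 2) (q : PadicAlgCl 2) (μt : IwasawaAlgebraO (Set.range ι)), π.KatoValuedClass g ι Ω F.Φ F.τ z c' w q μt := by
  intro W _ _ hcm hr hss ha hΔ M _ g ι Ω hM hg hcmg hg2 hΩ hcong κ γ hκ hγ hvar S₀ hS₀a hS₀b hS₀c Lp Lm d hPol hLm₁ hLm₂ n ρ Θ hfrob hΘ ϖ hϖ
    Sg _ hSg₁ hSg₂ hSg₃ hfin I _ _ hIC π F
  exact childA_conclusion_of_litAtPins π g ι Ω (fun Φ φ hΦφ ζ₂ hζ₂ τ hτ =>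
    hK π.v π.hv W κ γ hκ hγ M g ι Ω hg hg2 hΩ n ρ hfrob (Θ π.v π.hv) (hΘ π.v π.hv) π.t₀ π.ht₀ π.nb π.bO π.bO' π.hbO π.ζ π.hζ π.ePk π.hμPk
      π.hadd₁Pk π.hadd₂Pk π.hgalPk π.hePk I hIC π.pair π.hpair Φ φ hΦφ ζ₂ hζ₂ τ hτ) F

end Summit.BirchSwinnertonDyer.BirchSwinnertonDyer.Cruxes.ResidualThetaCountLowerPureAtTwo.SideaK3G28

end
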